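import Summits.QuantumFields.YangMills.Theorems.SwapVirialDeficitZeroModeSigmaFourSmallBallHub
import HarnessLib

/-!
# W6 (T4), part I — the HUB WEIGHT ON THE TIP: `∫_{‖a‖ < 1, ‖Im a‖ < s₀} hubW ≤ 3^{−4/3}·I(1/3)·(I(4/9)·s₀^{1/9})³ = C·s₀^{1/3}`
# (free-hands support of ⟨stmt-QuantumFields-24197⟩; brick W6 (T4) «L-independent σ-block TIP SHARE, κ > 0» of LEAD ym-line-sfw-p2 g97's steep-window
# Morse–Bott plan, memo sfw-p2-g97-memo-24197-steep-window-morse-bott.md §1 (B-tip))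

(T4) of the LEAD memo asks for the σ-twisted four-leader small ball RESTRICTED TO TIP HUBS (hub angle `sin ψ < s₀`) with a POWER of `s₀`:
`Haar⁴(sigmaBall t ∩ {tip}) ≤ C·t⁷·s₀^κ`.  w2 g56's dominator (✓`indicator_rescaledSigma_axis_le_sigmaDom`, ✓`lintegral_sigmaDom_le`, ✓`ofReal_hubK_axis_le`) reduces
this — for EVERY scale `t` — to the cone integral of the hub weight `hubW(a) = (a₀²)^{−1/3}(‖Im a‖²)^{−4/3}` over the tip hubs; ✓`lintegral_ball_hubW_lt_top` proved
finiteness over the whole ball by AM–GM and a product of four one-dimensional singular integrals `I(c) = ∫_{u²<1}(u²)^{−c}`.  This file gives the RATE on the tip: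

* §1 ★ `lintegral_sqBox_singPow_scaled` — the SCALED singular box integral `∫_{u² < s²} (u²)^{−c} du = s^{1−2c}·I(c)` (`s > 0`; Lebesgue scaling on `ℝ`);
* §2 ★★ `lintegral_ballTip_hubW_le` — `∫_{‖a‖<1, ‖Im a‖<s₀} hubW ≤ 3^{−4/3}·I(1/3)·(s₀^{1/9}·I(4/9))³` (`0 < s₀`): on the tip every imaginary coordinate lies in
  the box `u² < s₀²`, so the three transverse factors scale by `s₀^{1/9}` each — the exponent `κ = 1/3` of (T4);
  ★★ `lintegral_coneTip_hubW_le` — the `coneMeasure` form (`× coneConst`), and `lintegral_coneTip_hubW_lt_top`.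
Part II (the small ball and its Laplace transform on the tip) consumes §2 through the dominator.

HONEST LABEL: four-dimensional real analysis with absolute constants; no statement about the ring; (T1)–(T3), W3∕W4∕W9 and ⟨24197⟩ ∕ ⟨24196⟩ ∕ ⟨24194⟩ ∕ ⟨24497⟩ OPEN;
own crux ⟨22884⟩ OPEN (blocked-on ⟨19935⟩); no crux, rung of record or summit is proved; the Yang–Mills mass gap is NOT proved; no summit is proved by a line.
THEOREMS ONLY (0 `def`, 0 `sorry`), standard axioms; the series' local `ℍ` instances.  Width seat ym-line-sfw-p2-w3 g65 (cell ym-idea-1, free hands),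
`--supports stmt-QuantumFields-24197`.  References: [cite: GonzalezarroyoAltes1988]; [cite: Vanbaal2001]; [folklore].
-/

set_option autoImplicit false

noncomputable section

open MeasureTheory Quaternion Set
open scoped Quaternion ENNReal BigOperators
open Literature.MathematicalPhysics.QuantumLattice
open Summit.QuantumFields.YangMills.Theorems.SwapTwistDeficit.ToronLog
open Summit.QuantumFields.YangMills.Theorems.SwapVirialDeficit.ZeroModeGroup

attribute [local instance] Literature.Analysis.FluidPDE.Tao2016.quatMeasurableSpace
  Literature.Analysis.FluidPDE.Tao2016.quatBorelSpace

namespace Summit.QuantumFields.YangMills.Theorems.SwapVirialDeficit.ZeroModeSigma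

/-! ## §1 The scaled singular box integral -/

/-- Scaling of the singular power: `singPow c (s·v) = (s²)^{−c} · singPow c v` for `s ≠ 0`. [folklore] -/
theorem singPow_mul_left (c : ℝ) {s : ℝ} (hs : s ≠ 0) (v : ℝ) : singPow c (s * v) = ENNReal.ofReal ((s ^ 2) ^ (-c)) * singPow c v := by
  have hsc : ENNReal.ofReal ((s ^ 2) ^ (-c)) ≠ 0 := (ENNReal.ofReal_pos.2 (Real.rpow_pos_of_pos (by positivity) _)).ne'
  by_cases hv : v = 0
  · rw [hv, mul_zero, singPow_zero, ENNReal.mul_top hsc]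
  · rw [singPow_of_ne (mul_ne_zero hs hv), singPow_of_ne hv, ← ENNReal.ofReal_mul (Real.rpow_nonneg (sq_nonneg _) _), mul_pow,
      Real.mul_rpow (sq_nonneg _) (sq_nonneg _)]

/-- The scaled box is the preimage of the unit box: `(s·v)² < s² ↔ v² < 1` (`s ≠ 0`). [folklore] -/
theorem sqBox_scaled_iff {s : ℝ} (hs : s ≠ 0) (v : ℝ) : (s * v) ^ 2 < s ^ 2 ↔ v ^ 2 < 1 := by
  have hs2 : 0 < s ^ 2 := by positivity
  rw [mul_pow]
  constructor
  · intro h; nlinarith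
  · intro h; nlinarith

/-- The scaled singular box integrand is measurable. [folklore] -/
theorem measurable_boxSing_scaled (c s : ℝ) : Measurable fun u => {u : ℝ | u ^ 2 < s ^ 2}.indicator (singPow c) u :=
  (measurable_singPow c).indicator (measurableSet_lt (measurable_id.pow_const 2) measurable_const)

/-- ★ **THE SCALED SINGULAR BOX INTEGRAL**: `∫_{u² < s²} (u²)^{−c} du = s^{1−2c}·I(c)` for `s > 0`, i.e.
`∫⁻ 𝟙_{u²<s²}·singPow c = ofReal s · ofReal((s²)^{−c}) · Ising c` (Lebesgue scaling `u = s·v` on `ℝ`, Mathlib `Real.map_volume_mul_left`). [folklore] -/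
theorem lintegral_sqBox_singPow_scaled (c : ℝ) {s : ℝ} (hs : 0 < s) :
    ∫⁻ u, {u : ℝ | u ^ 2 < s ^ 2}.indicator (singPow c) u = ENNReal.ofReal s * ENNReal.ofReal ((s ^ 2) ^ (-c)) * Ising c := by
  set F : ℝ → ℝ≥0∞ := fun u => {u : ℝ | u ^ 2 < s ^ 2}.indicator (singPow c) u with hF
  have hFm : Measurable F := measurable_boxSing_scaled c s
  -- `∫ F(s v) dv = s⁻¹ ∫ F`
  have hmap : ∫⁻ v, F (s * v) = ENNReal.ofReal |s⁻¹| * ∫⁻ u, F u := by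
    rw [← lintegral_map hFm (measurable_const_mul s), Real.map_volume_mul_left hs.ne', lintegral_smul_measure, smul_eq_mul]
  -- `F(s v) = (s²)^{−c} · 𝟙_{v²<1} singPow c v`
  have hcomp : ∀ v, F (s * v) = ENNReal.ofReal ((s ^ 2) ^ (-c)) * {u : ℝ | u ^ 2 < 1}.indicator (singPow c) v := by
    intro v
    simp only [hF]
    by_cases hv : v ^ 2 < 1
    · have hm : s * v ∈ {u : ℝ | u ^ 2 < s ^ 2} := (sqBox_scaled_iff hs.ne' v).2 hv
      rw [indicator_of_mem hm, indicator_of_mem (show v ∈ {u : ℝ | u ^ 2 < 1} from hv), singPow_mul_left c hs.ne']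
    · have hm : s * v ∉ {u : ℝ | u ^ 2 < s ^ 2} := fun h => hv ((sqBox_scaled_iff hs.ne' v).1 h)
      rw [indicator_of_notMem hm, indicator_of_notMem (show v ∉ {u : ℝ | u ^ 2 < 1} from hv), mul_zero]
  have hsc : ∫⁻ v, F (s * v) = ENNReal.ofReal ((s ^ 2) ^ (-c)) * Ising c := by
    simp only [hcomp]
    rw [lintegral_const_mul _ (measurable_boxSing c)]
    rfl
  -- solve for `∫ F`
  have hsinv : ENNReal.ofReal |s⁻¹| = (ENNReal.ofReal s)⁻¹ := by
    rw [abs_of_pos (inv_pos.2 hs), ENNReal.ofReal_inv_of_pos hs]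
  have hs0 : ENNReal.ofReal s ≠ 0 := (ENNReal.ofReal_pos.2 hs).ne'
  have key : ∫⁻ u, F u = ENNReal.ofReal s * ∫⁻ v, F (s * v) := by
    rw [hmap, hsinv, ← mul_assoc, ENNReal.mul_inv_cancel hs0 ENNReal.ofReal_ne_top, one_mul]
  rw [key, hsc, mul_assoc]

/-- Corollary with the power collected: for `s > 0` and any `c`, `ofReal s · ofReal((s²)^{−c}) = ofReal(s^{1−2c})`. [folklore] -/
theorem ofReal_mul_ofReal_sq_rpow {s : ℝ} (hs : 0 < s) (c : ℝ) :
    ENNReal.ofReal s * ENNReal.ofReal ((s ^ 2) ^ (-c)) = ENNReal.ofReal (s ^ (1 - 2 * c)) := by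
  rw [← ENNReal.ofReal_mul hs.le]
  congr 1
  rw [← Real.rpow_natCast, ← Real.rpow_mul hs.le, show ((2 : ℕ) : ℝ) * -c = -(2 * c) by push_cast; ring,
    show (1 : ℝ) - 2 * c = 1 + -(2 * c) by ring, Real.rpow_add hs, Real.rpow_one]

/-! ## §2 The hub weight on the tip of the unit ball -/

/-- ★★ **THE HUB WEIGHT ON THE TIP**: for `0 < s₀`,
`∫ 𝟙{‖a‖ < 1 ∧ ‖Im a‖ < s₀}·hubW(a) da ≤ 3^{−4/3} · I(1/3) · (ofReal s₀·ofReal((s₀²)^{−4/9})·I(4/9))³`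
— i.e. `≤ C·s₀^{1/3}`, the power `κ = 1/3` of the LEAD memo's (T4) (AM–GM ✓`hub_bound` on `‖Im a‖²`, every imaginary coordinate in the box `u² < s₀²`, §1).
[folklore] -/
theorem lintegral_ballTip_hubW_le {s₀ : ℝ} (hs₀ : 0 < s₀) :
    ∫⁻ a : ℍ, {a : ℍ | ‖a‖ < 1 ∧ ‖a.im‖ < s₀}.indicator hubW a ≤
      ENNReal.ofReal ((3:ℝ) ^ (-(4/3 : ℝ))) * (Ising (1/3) *
        ((ENNReal.ofReal s₀ * ENNReal.ofReal ((s₀ ^ 2) ^ (-(4/9 : ℝ))) * Ising (4/9)) *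
          ((ENNReal.ofReal s₀ * ENNReal.ofReal ((s₀ ^ 2) ^ (-(4/9 : ℝ))) * Ising (4/9)) *
            (ENNReal.ofReal s₀ * ENNReal.ofReal ((s₀ ^ 2) ^ (-(4/9 : ℝ))) * Ising (4/9))))) := by
  set T : Set (ℝ × (ℝ × (ℝ × ℝ))) := {p : ℝ × (ℝ × (ℝ × ℝ)) | p.1 ^ 2 + p.2.1 ^ 2 + p.2.2.1 ^ 2 + p.2.2.2 ^ 2 < 1} ∩
      {p : ℝ × (ℝ × (ℝ × ℝ)) | p.2.1 ^ 2 + p.2.2.1 ^ 2 + p.2.2.2 ^ 2 < s₀ ^ 2} with hT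
  set f : ℝ × (ℝ × (ℝ × ℝ)) → ℝ≥0∞ := fun p => T.indicator
      (fun p => singPow (1/3) p.1 * singPow (4/3) (Real.sqrt (p.2.1 ^ 2 + p.2.2.1 ^ 2 + p.2.2.2 ^ 2))) p with hf
  have hTm : MeasurableSet T :=
    (measurableSet_lt (by fun_prop : Measurable fun p : ℝ × (ℝ × (ℝ × ℝ)) => p.1 ^ 2 + p.2.1 ^ 2 + p.2.2.1 ^ 2 + p.2.2.2 ^ 2) measurable_const).inter
      (measurableSet_lt (by fun_prop : Measurable fun p : ℝ × (ℝ × (ℝ × ℝ)) => p.2.1 ^ 2 + p.2.2.1 ^ 2 + p.2.2.2 ^ 2) measurable_const)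
  have hfm : Measurable f :=
    (((measurable_singPow _).comp measurable_fst).mul ((measurable_singPow _).comp
      ((by fun_prop : Measurable fun p : ℝ × (ℝ × (ℝ × ℝ)) => p.2.1 ^ 2 + p.2.2.1 ^ 2 + p.2.2.2 ^ 2).sqrt))).indicator hTm
  have him_sq : ∀ a : ℍ, ‖a.im‖ ^ 2 = a.imI ^ 2 + a.imJ ^ 2 + a.imK ^ 2 := fun a => by rw [sq_norm_eq_sum_sq]; simp
  have him_eq : ∀ a : ℍ, ‖a.im‖ = Real.sqrt (a.imI ^ 2 + a.imJ ^ 2 + a.imK ^ 2) := fun a => by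
    rw [← him_sq, Real.sqrt_sq (norm_nonneg _)]
  have he : ∀ a : ℍ, {a : ℍ | ‖a‖ < 1 ∧ ‖a.im‖ < s₀}.indicator hubW a = f (coord4 a) := by
    intro a
    have hmem : a ∈ {a : ℍ | ‖a‖ < 1 ∧ ‖a.im‖ < s₀} ↔ coord4 a ∈ T := by
      show ‖a‖ < 1 ∧ ‖a.im‖ < s₀ ↔ a.re ^ 2 + a.imI ^ 2 + a.imJ ^ 2 + a.imK ^ 2 < 1 ∧ a.imI ^ 2 + a.imJ ^ 2 + a.imK ^ 2 < s₀ ^ 2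
      rw [← sq_norm_eq_sum_sq, ← him_sq, pow_lt_one_iff_of_nonneg (norm_nonneg _) two_ne_zero, pow_lt_pow_iff_left₀ (norm_nonneg _) hs₀.le two_ne_zero]
    simp only [hf]
    by_cases hm : a ∈ {a : ℍ | ‖a‖ < 1 ∧ ‖a.im‖ < s₀}
    · rw [indicator_of_mem hm, indicator_of_mem (hmem.1 hm), hubW, him_eq]; rfl
    · rw [indicator_of_notMem hm, indicator_of_notMem (fun h => hm (hmem.2 h))]
  rw [lintegral_congr he, measurePreserving_coord4.lintegral_comp hfm]
  have hC : ENNReal.ofReal ((3:ℝ) ^ (-(4/3 : ℝ))) ≠ 0 := (ENNReal.ofReal_pos.2 (Real.rpow_pos_of_pos (by norm_num) _)).ne'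
  -- pointwise: the real part in the unit box, every imaginary coordinate in the box of size `s₀`
  have hbd : ∀ p, f p ≤ ENNReal.ofReal ((3:ℝ) ^ (-(4/3 : ℝ))) * ({u : ℝ | u ^ 2 < 1}.indicator (singPow (1/3)) p.1 *
      ({u : ℝ | u ^ 2 < s₀ ^ 2}.indicator (singPow (4/9)) p.2.1 * ({u : ℝ | u ^ 2 < s₀ ^ 2}.indicator (singPow (4/9)) p.2.2.1 *
        {u : ℝ | u ^ 2 < s₀ ^ 2}.indicator (singPow (4/9)) p.2.2.2))) := by
    intro p
    by_cases hm : p ∈ T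
    swap
    · simp only [hf]; rw [indicator_of_notMem hm]; exact bot_le
    have hm1 : p.1 ^ 2 + p.2.1 ^ 2 + p.2.2.1 ^ 2 + p.2.2.2 ^ 2 < 1 := hm.1
    have hm2 : p.2.1 ^ 2 + p.2.2.1 ^ 2 + p.2.2.2 ^ 2 < s₀ ^ 2 := hm.2
    have h0 : p.1 ∈ {u : ℝ | u ^ 2 < 1} := by
      show p.1 ^ 2 < 1; nlinarith [sq_nonneg p.2.1, sq_nonneg p.2.2.1, sq_nonneg p.2.2.2]
    have h1 : p.2.1 ∈ {u : ℝ | u ^ 2 < s₀ ^ 2} := by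
      show p.2.1 ^ 2 < s₀ ^ 2; nlinarith [sq_nonneg p.2.2.1, sq_nonneg p.2.2.2]
    have h2 : p.2.2.1 ∈ {u : ℝ | u ^ 2 < s₀ ^ 2} := by
      show p.2.2.1 ^ 2 < s₀ ^ 2; nlinarith [sq_nonneg p.2.1, sq_nonneg p.2.2.2]
    have h3 : p.2.2.2 ∈ {u : ℝ | u ^ 2 < s₀ ^ 2} := by
      show p.2.2.2 ^ 2 < s₀ ^ 2; nlinarith [sq_nonneg p.2.1, sq_nonneg p.2.2.1]
    simp only [hf]
    rw [indicator_of_mem hm, indicator_of_mem h0, indicator_of_mem h1, indicator_of_mem h2, indicator_of_mem h3]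
    by_cases z0 : p.1 = 0
    · rw [z0, singPow_zero, ENNReal.top_mul (mul_ne_zero (singPow_ne_zero _ _) (mul_ne_zero (singPow_ne_zero _ _) (singPow_ne_zero _ _))),
        ENNReal.mul_top hC]
      exact le_top
    by_cases z1 : p.2.1 = 0
    · rw [z1, singPow_zero, ENNReal.top_mul (mul_ne_zero (singPow_ne_zero _ _) (singPow_ne_zero _ _)), ENNReal.mul_top (singPow_ne_zero _ _),
        ENNReal.mul_top hC]
      exact le_top
    by_cases z2 : p.2.2.1 = 0
    · rw [z2, singPow_zero, ENNReal.top_mul (singPow_ne_zero _ _), ENNReal.mul_top (singPow_ne_zero _ _), ENNReal.mul_top (singPow_ne_zero _ _),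
        ENNReal.mul_top hC]
      exact le_top
    by_cases z3 : p.2.2.2 = 0
    · rw [z3, singPow_zero, ENNReal.mul_top (singPow_ne_zero _ _), ENNReal.mul_top (singPow_ne_zero _ _), ENNReal.mul_top (singPow_ne_zero _ _),
        ENNReal.mul_top hC]
      exact le_top
    have hS : 0 < p.2.1 ^ 2 + p.2.2.1 ^ 2 + p.2.2.2 ^ 2 := by positivity
    have hsq : Real.sqrt (p.2.1 ^ 2 + p.2.2.1 ^ 2 + p.2.2.2 ^ 2) ≠ 0 := (Real.sqrt_pos.2 hS).ne'
    rw [singPow_of_ne z0, singPow_of_ne hsq, singPow_of_ne z1, singPow_of_ne z2, singPow_of_ne z3, Real.sq_sqrt hS.le,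
      ← ENNReal.ofReal_mul (Real.rpow_nonneg (sq_nonneg _) _), ← ENNReal.ofReal_mul (Real.rpow_nonneg (sq_nonneg _) _),
      ← ENNReal.ofReal_mul (Real.rpow_nonneg (sq_nonneg _) _), ← ENNReal.ofReal_mul (Real.rpow_nonneg (sq_nonneg _) _),
      ← ENNReal.ofReal_mul (Real.rpow_nonneg (by norm_num) _)]
    refine ENNReal.ofReal_le_ofReal ?_
    have hb := hub_bound z1 z2 z3
    have h0' : 0 ≤ (p.1 ^ 2) ^ (-(1/3 : ℝ)) := Real.rpow_nonneg (sq_nonneg _) _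
    calc (p.1 ^ 2) ^ (-(1/3 : ℝ)) * (p.2.1 ^ 2 + p.2.2.1 ^ 2 + p.2.2.2 ^ 2) ^ (-(4/3 : ℝ))
        ≤ (p.1 ^ 2) ^ (-(1/3 : ℝ)) * ((3:ℝ) ^ (-(4/3 : ℝ)) * ((p.2.1 ^ 2) ^ (-(4/9 : ℝ)) * (p.2.2.1 ^ 2) ^ (-(4/9 : ℝ)) * (p.2.2.2 ^ 2) ^ (-(4/9 : ℝ)))) :=
          mul_le_mul_of_nonneg_left hb h0'
      _ = _ := by ring
  have hm3 : Measurable fun v : ℝ × ℝ => {u : ℝ | u ^ 2 < s₀ ^ 2}.indicator (singPow (4/9)) v.1 * {u : ℝ | u ^ 2 < s₀ ^ 2}.indicator (singPow (4/9)) v.2 :=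
    ((measurable_boxSing_scaled _ _).comp measurable_fst).mul ((measurable_boxSing_scaled _ _).comp measurable_snd)
  have hm2 : Measurable fun u : ℝ × (ℝ × ℝ) => {u : ℝ | u ^ 2 < s₀ ^ 2}.indicator (singPow (4/9)) u.1 *
      ({u : ℝ | u ^ 2 < s₀ ^ 2}.indicator (singPow (4/9)) u.2.1 * {u : ℝ | u ^ 2 < s₀ ^ 2}.indicator (singPow (4/9)) u.2.2) :=
    ((measurable_boxSing_scaled _ _).comp measurable_fst).mul (hm3.comp measurable_snd)
  have hm1 : Measurable fun p : ℝ × (ℝ × (ℝ × ℝ)) => {u : ℝ | u ^ 2 < 1}.indicator (singPow (1/3)) p.1 *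
      ({u : ℝ | u ^ 2 < s₀ ^ 2}.indicator (singPow (4/9)) p.2.1 * ({u : ℝ | u ^ 2 < s₀ ^ 2}.indicator (singPow (4/9)) p.2.2.1 *
        {u : ℝ | u ^ 2 < s₀ ^ 2}.indicator (singPow (4/9)) p.2.2.2)) :=
    ((measurable_boxSing _).comp measurable_fst).mul (hm2.comp measurable_snd)
  calc ∫⁻ p, f p ≤ ∫⁻ p : ℝ × (ℝ × (ℝ × ℝ)), ENNReal.ofReal ((3:ℝ) ^ (-(4/3 : ℝ))) * ({u : ℝ | u ^ 2 < 1}.indicator (singPow (1/3)) p.1 *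
      ({u : ℝ | u ^ 2 < s₀ ^ 2}.indicator (singPow (4/9)) p.2.1 * ({u : ℝ | u ^ 2 < s₀ ^ 2}.indicator (singPow (4/9)) p.2.2.1 *
        {u : ℝ | u ^ 2 < s₀ ^ 2}.indicator (singPow (4/9)) p.2.2.2))) := lintegral_mono hbd
    _ = ENNReal.ofReal ((3:ℝ) ^ (-(4/3 : ℝ))) * (Ising (1/3) *
        ((∫⁻ u, {u : ℝ | u ^ 2 < s₀ ^ 2}.indicator (singPow (4/9)) u) * ((∫⁻ u, {u : ℝ | u ^ 2 < s₀ ^ 2}.indicator (singPow (4/9)) u) *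
          (∫⁻ u, {u : ℝ | u ^ 2 < s₀ ^ 2}.indicator (singPow (4/9)) u)))) := by
        rw [lintegral_const_mul _ hm1, lintegral_volume_prod_mul (measurable_boxSing _) hm2,
          lintegral_volume_prod_mul (measurable_boxSing_scaled _ _) hm3,
          lintegral_volume_prod_mul (measurable_boxSing_scaled _ _) (measurable_boxSing_scaled _ _)]
        rfl
    _ = _ := by rw [lintegral_sqBox_singPow_scaled (4/9) hs₀]

/-- ★★ **THE HUB WEIGHT ON THE TIP OF THE CONE** (`coneMeasure` form): for `0 < s₀`,
`∫ 𝟙{‖Im a‖ < s₀}·hubW dcone ≤ coneConst · 3^{−4/3} · I(1/3) · (ofReal s₀·ofReal((s₀²)^{−4/9})·I(4/9))³` (`= C·s₀^{1/3}`, ✓`lintegral_coneMeasure_eq`). [folklore] -/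
theorem lintegral_coneTip_hubW_le {s₀ : ℝ} (hs₀ : 0 < s₀) :
    ∫⁻ a, {a : ℍ | ‖a.im‖ < s₀}.indicator hubW a ∂coneMeasure ≤
      ENNReal.ofReal coneConst * (ENNReal.ofReal ((3:ℝ) ^ (-(4/3 : ℝ))) * (Ising (1/3) *
        ((ENNReal.ofReal s₀ * ENNReal.ofReal ((s₀ ^ 2) ^ (-(4/9 : ℝ))) * Ising (4/9)) *
          ((ENNReal.ofReal s₀ * ENNReal.ofReal ((s₀ ^ 2) ^ (-(4/9 : ℝ))) * Ising (4/9)) *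
            (ENNReal.ofReal s₀ * ENNReal.ofReal ((s₀ ^ 2) ^ (-(4/9 : ℝ))) * Ising (4/9)))))) := by
  rw [lintegral_coneMeasure_eq]
  refine mul_le_mul' le_rfl ?_
  have he : ∀ a : ℍ, (Metric.ball (0:ℍ) 1).indicator (fun a => {a : ℍ | ‖a.im‖ < s₀}.indicator hubW a) a =
      {a : ℍ | ‖a‖ < 1 ∧ ‖a.im‖ < s₀}.indicator hubW a := by
    intro a
    by_cases h1 : a ∈ Metric.ball (0:ℍ) 1
    · have h1' : ‖a‖ < 1 := by simpa using h1
      by_cases h2 : ‖a.im‖ < s₀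
      · rw [indicator_of_mem h1, indicator_of_mem (show a ∈ {a : ℍ | ‖a.im‖ < s₀} from h2),
          indicator_of_mem (show a ∈ {a : ℍ | ‖a‖ < 1 ∧ ‖a.im‖ < s₀} from ⟨h1', h2⟩)]
      · rw [indicator_of_mem h1, indicator_of_notMem (show a ∉ {a : ℍ | ‖a.im‖ < s₀} from h2),
          indicator_of_notMem (show a ∉ {a : ℍ | ‖a‖ < 1 ∧ ‖a.im‖ < s₀} from fun h => h2 h.2)]
    · rw [indicator_of_notMem h1, indicator_of_notMem (show a ∉ {a : ℍ | ‖a‖ < 1 ∧ ‖a.im‖ < s₀} from fun h => h1 (by simpa using h.1))]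
  rw [lintegral_congr he]
  exact lintegral_ballTip_hubW_le hs₀

/-- The tip hub-weight integral is finite. [folklore] -/
theorem lintegral_coneTip_hubW_lt_top (s₀ : ℝ) : ∫⁻ a, {a : ℍ | ‖a.im‖ < s₀}.indicator hubW a ∂coneMeasure < ∞ := by
  refine lt_of_le_of_lt (lintegral_mono fun a => ?_) lintegral_cone_hubW_lt_top
  exact Set.indicator_le_self _ _ a

end Summit.QuantumFields.YangMills.Theorems.SwapVirialDeficit.ZeroModeSigma

end
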